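import Mathlib
import HarnessLib
import Summits.AtomisticToContinuum.FouriersLaw.Theses.JunctionLocality
import Summits.AtomisticToContinuum.FouriersLaw.Theorems.JunctionLocalitySuperadditiveResistanceDeviceLiouville
import Summits.AtomisticToContinuum.FouriersLaw.Theorems.JunctionLocalitySuperadditiveResistancePlainAdjoint
import Summits.AtomisticToContinuum.FouriersLaw.Theorems.JunctionLocalityConductanceLowerBoundStubKuboLink
import Summits.AtomisticToContinuum.FouriersLaw.Theorems.JunctionLocalityConductanceLowerBoundRelocForwardFieldOfResolventBound
import Summits.AtomisticToContinuum.FouriersLaw.Theorems.JunctionLocalitySuperadditiveResistanceStubDeviceForwardFieldsAux6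
import Summits.AtomisticToContinuum.FouriersLaw.Theorems.JunctionLocalitySuperadditiveResistanceStubPlainForwardField
import Summits.AtomisticToContinuum.FouriersLaw.Theorems.JunctionLocalityConductanceLowerBoundStubRelocPositiveConductanceResolvent
import Summits.AtomisticToContinuum.FouriersLaw.Theorems.JunctionLocalityConductanceLowerBoundStubContactFormationResolvent
import Summits.AtomisticToContinuum.FouriersLaw.Theorems.JunctionLocalityConductanceLowerBoundStubKuboLinkResolvent

/-!
# `ConductanceLowerBound` from the ONE remaining stub of line `cold-bath-relocation-walk` (crux stmt-AtomisticToContinuum-11749)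

Helper file (`--supports stmt-AtomisticToContinuum-11749`) of line `cold-bath-relocation-walk` (lead c2), RESOLVENT FRAME.  The line keeps ONE
`L`-site Hamiltonian and its Gibbs state `μ_T` and moves only the cold thermostat: `L_m = X_H + γ(S_0 + S_m)`; it walks the Kubo conductance
`G[u] = γ(1 − γ⟨u, p_0² − T⟩/T²)` of the RESOLVENT fields `u^λ_m = (λ − L_m)⁻¹(p_0² − T)` (which exist unconditionally, `exists_resolventField`)
from `m = 1` to `m = L − 1`, and lets `λ → 0` at the end placement, where `L_{L−1} = L_{T,T}` and the Kubo link turns `⟨g, p_0²−T⟩` into `D_L`.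
With the inputs landed by the line —
* `stub_relocPositiveConductance_resolvent` (R3λ, p131595): `G[u^λ_m] > 0`;
* `stub_contactFormation_resolvent` (R4λ, p132132): `G[u^λ_1] ≥ c₀ > 0` uniformly in `L` (the curl certificate `φ = p_0F_1 − p_1F_0`);
* `stub_kuboLink_resolvent` (ENDλ, p131939): `⟨u^λ_{L−1}, k_0⟩ → ⟨g, k_0⟩` as `λ → 0⁺`;
* `ForecastSensitivity.stub_kuboLink` (p95958): `D_L/(L−1) = G[g]`;
* `FloatingProbeBypassLaplacian.stub_plainForwardField`: the plain forward field `g` exists —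
the crux follows from the single remaining (registered, OPEN) stub `stub_bulkStep_resolvent` (R5λ, the line's bet: one-site relocation of the cold
bath lowers the conductance by at most `C·G·G'`), which this file takes as a HYPOTHESIS (spelled out verbatim):
`conductanceLowerBound_of_bulkStep_resolvent : R5λ → ConductanceLowerBound`, with `c = 1/(1/c₀ + C)`, `N₁ = 2`.
No definitions beyond the two-site weight vector (a `theorem`-free abbreviation is avoided: the weights are written as a lambda); kernel-checked;
axioms standard.
-/

noncomputable section

open MeasureTheory Filter Topology
open scoped ContDiff
open Literature.MathematicalPhysics.KineticTheory.HeatConduction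
open Summit.AtomisticToContinuum.FouriersLaw.Theorems.SuperadditiveResistance.DeviceLiouville
  (kin thermo liouvilleOp bathOp generator_eq_liouvilleOp_add)
open Summit.AtomisticToContinuum.FouriersLaw.Cruxes.SuperadditiveResistance.FloatingProbeBypassLaplacian
  (exists_resolventField pinnedChain_memLp_two_kin stub_plainForwardField)

namespace Summit.AtomisticToContinuum.FouriersLaw.Cruxes.ConductanceLowerBound.ColdBathRelocationWalk

/-- **Relocated RESOLVENT fields exist** for every `λ > 0`, every `L ≥ 1` and every cold-bath position `m`: a `C²` (indeed smooth)
`u ∈ L²(μ_T)` with `λu − (X_H u + γ(S_0 + S_m)u) = p_0² − T` pointwise — the landed essential m-dissipativity `exists_resolventField`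
(general weights `B ≥ 0` with `B_0 > 0`) for `B = 𝟙_0 + 𝟙_m`, rewritten with the landed bridge `bathOp_twoSite_eq_thermo`. [folklore] -/
theorem relocResolventField_exists' {ω₂ lam β γ T : ℝ} (hω : 0 < ω₂) (hl : 0 ≤ lam) (hβ : 0 ≤ β) (hγ : 0 < γ)
    (hT : 0 < T) {L : ℕ} (hL : 0 < L) (m : ℕ) {l : ℝ} (hlpos : 0 < l) :
    ∃ u : PhaseSpace L → ℝ, ContDiff ℝ 2 u ∧ MemLp u 2 ((pinnedChain ω₂ lam β γ).gibbsMeasure L T) ∧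
      ∀ x, l * u x - (liouvilleOp (pinnedChain ω₂ lam β γ) L u x + γ * (thermo L 0 T u x + thermo L m T u x)) =
        kin L 0 x - T := by
  have hks : ContDiff ℝ ∞ (fun x : PhaseSpace L => kin L 0 x - T) := contDiff_kin_sub_const L 0 T
  haveI := pinnedChain_isProbabilityMeasure_gibbsMeasure hω hl hβ γ L hT
  have hk2 : MemLp (fun x : PhaseSpace L => kin L 0 x - T) 2 ((pinnedChain ω₂ lam β γ).gibbsMeasure L T) :=
    (pinnedChain_memLp_two_kin hω hl hβ γ L 0 hT).sub (memLp_const T)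
  have hBnn : ∀ i : Fin L, 0 ≤ (fun i : Fin L => (if i.val = 0 then (1 : ℝ) else 0) + (if i.val = m then 1 else 0)) i :=
    fun i => by
      dsimp only
      split_ifs <;> norm_num
  have hB0 : 0 < (fun i : Fin L => (if i.val = 0 then (1 : ℝ) else 0) + (if i.val = m then 1 else 0)) ⟨0, hL⟩ := by
    have h0 : ((⟨0, hL⟩ : Fin L).val = 0) := rfl
    dsimp only
    rw [if_pos h0]
    split_ifs <;> norm_num
  obtain ⟨u, huC, hu2, hpde⟩ := exists_resolventField hω hl hβ γ hL hT one_ne_zero hγ hBnn hB0 hlpos hks hk2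
  refine ⟨u, huC.of_le (by norm_cast), hu2, fun x => ?_⟩
  have e := hpde x
  rw [one_mul, bathOp_twoSite_eq_thermo] at e
  exact e

/-- **The relocation walk, real-variable form**: if `G 1 ≥ c₀ > 0`, `G m > 0` for `1 ≤ m ≤ n`, and
`G m − G (m+1) ≤ C · G m · G (m+1)` for `1 ≤ m < n` (`C ≥ 0`), then `G (1+k) ≥ 1/(1/c₀ + C k)` for
`1 + k ≤ n`: the reciprocal `1/G` grows by at most `C` per step. [folklore] -/
theorem walk_lower_bound' {G : ℕ → ℝ} {c₀ C : ℝ} {n : ℕ} (hc₀ : 0 < c₀) (hC : 0 ≤ C)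
    (h1 : c₀ ≤ G 1) (hpos : ∀ m, 1 ≤ m → m ≤ n → 0 < G m)
    (hstep : ∀ m, 1 ≤ m → m + 1 ≤ n → G m - G (m + 1) ≤ C * G m * G (m + 1)) :
    ∀ k : ℕ, 1 + k ≤ n → 1 / (1 / c₀ + C * k) ≤ G (1 + k) := by
  intro k
  induction k with
  | zero =>
    intro _
    simpa using h1
  | succ k ih =>
    intro hk
    have hk' : 1 + k ≤ n := by omega
    have hIH := ih hk'
    set K : ℝ := 1 / c₀ + C * k with hK
    have hKpos : 0 < K := by positivity
    have ha : 0 < G (1 + k) := hpos (1 + k) (by omega) hk'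
    have e1 : 1 + (k + 1) = 1 + k + 1 := by omega
    rw [e1] at hk ⊢
    have hb : 0 < G (1 + k + 1) := hpos (1 + k + 1) (by omega) hk
    have hst : G (1 + k) - G (1 + k + 1) ≤ C * G (1 + k) * G (1 + k + 1) :=
      hstep (1 + k) (by omega) hk
    have haK : 1 ≤ G (1 + k) * K := by rwa [div_le_iff₀ hKpos] at hIH
    have hgoal : 1 ≤ G (1 + k + 1) * (K + C) := by
      have h2 : G (1 + k + 1) ≤ G (1 + k + 1) * (G (1 + k) * K) := le_mul_of_one_le_right hb.le haK
      have key : G (1 + k) * 1 ≤ G (1 + k) * (G (1 + k + 1) * (K + C)) := by nlinarith [h2, hst]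
      exact le_of_mul_le_mul_left key ha
    have hKC : 0 < K + C := by positivity
    have hden : (1 / c₀ + C * ((k + 1 : ℕ) : ℝ)) = K + C := by
      rw [hK]
      push_cast
      ring
    rw [hden, div_le_iff₀ hKC]
    exact hgoal

/-- **`ConductanceLowerBound` ⟸ R5λ (`stub_bulkStep_resolvent`), everything else landed.**  Fix `L ≥ 2` and `ε > 0`; choose `λ` below
the three thresholds `λ₀(L)` of R4λ, R5λ (hypothesis), ENDλ; resolvent fields `u^λ_m` exist for every `m`; R4λ, R3λ, R5λ feed the walk, so
`G[u^λ_{L−1}] ≥ 1/(1/c₀ + C(L−2))`; ENDλ moves this to the plain forward field `g` up to `(γ²/T²)ε`, the Kubo link reads `D_L/(L−1) = G[g]`;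
`ε → 0` and `(L−1)/(1/c₀ + C(L−2)) ≥ 1/(1/c₀ + C)` finish: `c = 1/(1/c₀ + C)`, `N₁ = 2`. -/
theorem conductanceLowerBound_of_bulkStep_resolvent :
    (∀ (ω₂ lam β γ T : ℝ), 0 < ω₂ → 0 < lam → 0 < β → 0 < γ → 0 < T → ∃ C : ℝ, 0 ≤ C ∧ ∀ (L : ℕ), ∃ l₀ : ℝ, 0 < l₀ ∧ ∀ (l : ℝ), 0 < l → l < l₀ → ∀ (m : ℕ), 1 ≤ m → m + 2 ≤ L → ∀ u : PhaseSpace L → ℝ, ContDiff ℝ 2 u → MemLp u 2 ((pinnedChain ω₂ lam β γ).gibbsMeasure L T) → (∀ x, l * u x - (liouvilleOp (pinnedChain ω₂ lam β γ) L u x + γ * (thermo L 0 T u x + thermo L m T u x)) = kin L 0 x - T) → ∀ u' : PhaseSpace L → ℝ, ContDiff ℝ 2 u' → MemLp u' 2 ((pinnedChain ω₂ lam β γ).gibbsMeasure L T) → (∀ x, l * u' x - (liouvilleOp (pinnedChain ω₂ lam β γ) L u' x + γ * (thermo L 0 T u' x + thermo L (m + 1) T u' x)) = kin L 0 x - T)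 → γ * (1 - γ / T ^ 2 * ∫ x, u x * (kin L 0 x - T) ∂((pinnedChain ω₂ lam β γ).gibbsMeasure L T)) - γ * (1 - γ / T ^ 2 * ∫ x, u' x * (kin L 0 x - T) ∂((pinnedChain ω₂ lam β γ).gibbsMeasure L T)) ≤ C * (γ * (1 - γ / T ^ 2 * ∫ x, u x * (kin L 0 x - T) ∂((pinnedChain ω₂ lam β γ).gibbsMeasure L T))) * (γ * (1 - γ / T ^ 2 * ∫ x, u' x * (kin L 0 x - T) ∂((pinnedChain ω₂ lam β γ).gibbsMeasure L T)))) →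
    Summit.AtomisticToContinuum.FouriersLaw.Theses.JunctionLocality.ConductanceLowerBound := by
  intro hR5 ω₂ lam β γ hω hl hβ hγ huniq μ hμ T hT D hD
  obtain ⟨c₀, hc₀, hcontact⟩ := stub_contactFormation_resolvent ω₂ lam β γ T hω hl hβ hγ hT
  obtain ⟨C, hC, hbulk⟩ := hR5 ω₂ lam β γ T hω hl hβ hγ hT
  refine ⟨1 / (1 / c₀ + C), by positivity, 2, fun L hL => ?_⟩
  have hL0 : 0 < L := by omega
  set P := pinnedChain ω₂ lam β γ with hP
  -- the plain forward field at the end placement and the Kubo link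
  obtain ⟨g, hgC, hgL2, hgmean, hgen⟩ :=
    stub_plainForwardField ω₂ lam β γ T hω hl hβ hγ hT L hL
  have hkubo :=
    Summit.AtomisticToContinuum.FouriersLaw.Cruxes.ConductanceLowerBound.ForecastSensitivity.stub_kuboLink ω₂ lam β γ μ T D
      hω hl hβ hγ hT huniq hμ hD L hL g hgC hgL2 hgmean hgen
  set Gg : ℝ := γ * (1 - γ / T ^ 2 * ∫ x, g x * (kin L 0 x - T) ∂(P.gibbsMeasure L T)) with hGg
  have hkubo' : D L / ((L : ℝ) - 1) = Gg := hkubo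
  -- thresholds
  obtain ⟨l₄, hl₄, h4⟩ := hcontact L hL
  obtain ⟨l₅, hl₅, h5⟩ := hbulk L
  -- the walk bound transferred to `Gg` up to an arbitrary `ε`
  have hmain : ∀ ε : ℝ, 0 < ε → 1 / (1 / c₀ + C * ((L : ℝ) - 2)) ≤ Gg + γ * (γ / T ^ 2) * ε := by
    intro ε hε
    obtain ⟨lE, hlE, hE⟩ := stub_kuboLink_resolvent ω₂ lam β γ T hω hl hβ hγ hT L hL ε hε
    set l : ℝ := min (min l₄ l₅) lE / 2 with hldef
    have hlpos : 0 < l := by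
      have : 0 < min (min l₄ l₅) lE := lt_min (lt_min hl₄ hl₅) hlE
      rw [hldef]; linarith
    have hl4' : l < l₄ := by
      have : min (min l₄ l₅) lE ≤ l₄ := le_trans (min_le_left _ _) (min_le_left _ _)
      rw [hldef]; linarith
    have hl5' : l < l₅ := by
      have : min (min l₄ l₅) lE ≤ l₅ := le_trans (min_le_left _ _) (min_le_right _ _)
      rw [hldef]; linarith
    have hlE' : l < lE := by
      have : min (min l₄ l₅) lE ≤ lE := min_le_right _ _
      rw [hldef]; linarith
    -- resolvent fields at every cold-bath position
    have hex : ∀ m : ℕ, ∃ u : PhaseSpace L → ℝ, ContDiff ℝ 2 u ∧ MemLp u 2 (P.gibbsMeasure L T) ∧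
        ∀ x, l * u x - (liouvilleOp P L u x + γ * (thermo L 0 T u x + thermo L m T u x)) = kin L 0 x - T :=
      fun m => relocResolventField_exists' hω hl.le hβ.le hγ hT hL0 m hlpos
    choose u hu using hex
    set G : ℕ → ℝ := fun m => γ * (1 - γ / T ^ 2 * ∫ x, u m x * (kin L 0 x - T) ∂(P.gibbsMeasure L T)) with hGdef
    have hGm : ∀ m, G m = γ * (1 - γ / T ^ 2 * ∫ x, u m x * (kin L 0 x - T) ∂(P.gibbsMeasure L T)) :=
      fun m => rfl
    have hG1 : c₀ ≤ G 1 := by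
      obtain ⟨h1, h2, h3⟩ := hu 1
      rw [hGm]; exact h4 l hlpos hl4' (u 1) h1 h2 h3
    have hGpos : ∀ m, 1 ≤ m → m ≤ L - 1 → 0 < G m := fun m _ hm2 => by
      obtain ⟨h1, h2, h3⟩ := hu m
      rw [hGm]
      exact stub_relocPositiveConductance_resolvent ω₂ lam β γ T hω hl hβ hγ hT L m (by omega) l hlpos (u m) h1 h2 h3
    have hGstep : ∀ m, 1 ≤ m → m + 1 ≤ L - 1 → G m - G (m + 1) ≤ C * G m * G (m + 1) := fun m hm1 hm2 => by
      obtain ⟨h1, h2, h3⟩ := hu m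
      obtain ⟨h1', h2', h3'⟩ := hu (m + 1)
      rw [hGm, hGm]
      exact h5 l hlpos hl5' m hm1 (by omega) (u m) h1 h2 h3 (u (m + 1)) h1' h2' h3'
    have hwalk := walk_lower_bound' hc₀ hC hG1 hGpos hGstep (L - 2) (by omega)
    have hLm : 1 + (L - 2) = L - 1 := by omega
    rw [hLm] at hwalk
    have hcast : ((L - 2 : ℕ) : ℝ) = (L : ℝ) - 2 := by
      rw [Nat.cast_sub hL]; norm_num
    rw [hcast] at hwalk
    -- move to the plain forward field: |S[u_{L-1}] − S[g]| < ε
    obtain ⟨h1, h2, h3⟩ := hu (L - 1)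
    have hend := hE l hlpos hlE' (u (L - 1)) h1 h2 h3 g hgC hgL2 hgmean hgen
    have hGL : G (L - 1) ≤ Gg + γ * (γ / T ^ 2) * ε := by
      rw [hGm, hGg]
      have hab := (abs_lt.mp hend)
      have hγ2 : 0 ≤ γ * (γ / T ^ 2) := by positivity
      nlinarith [hab.1, hab.2, hγ2]
    exact le_trans hwalk hGL
  -- `ε → 0`
  have hbound : 1 / (1 / c₀ + C * ((L : ℝ) - 2)) ≤ Gg := by
    refine le_of_forall_pos_le_add fun ε' hε' => ?_
    have hγ2 : 0 < γ * (γ / T ^ 2) := by positivity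
    have h := hmain (ε' / (γ * (γ / T ^ 2))) (by positivity)
    have heq : γ * (γ / T ^ 2) * (ε' / (γ * (γ / T ^ 2))) = ε' := by field_simp
    linarith [h, heq.le, heq.ge]
  -- arithmetic: `D_L = (L−1)·Gg ≥ (L−1)/(1/c₀ + C(L−2)) ≥ 1/(1/c₀ + C)`
  have hL2r : (2 : ℝ) ≤ (L : ℝ) := by exact_mod_cast hL
  have hL1 : (0 : ℝ) < (L : ℝ) - 1 := by linarith
  have hDL : D L = Gg * ((L : ℝ) - 1) := (div_eq_iff hL1.ne').mp hkubo'
  set e : ℝ := 1 / c₀ with he_def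
  have he : 0 < e := by positivity
  have hK : 0 < e + C * ((L : ℝ) - 2) := by
    have : (0 : ℝ) ≤ C * ((L : ℝ) - 2) := mul_nonneg hC (by linarith)
    linarith
  rw [hDL]
  calc 1 / (e + C) ≤ 1 / (e + C * ((L : ℝ) - 2)) * ((L : ℝ) - 1) := by
        rw [div_mul_eq_mul_div, one_mul, le_div_iff₀ hK, div_mul_eq_mul_div, one_mul,
          div_le_iff₀ (by positivity : (0 : ℝ) < e + C)]
        nlinarith [mul_nonneg he.le (show (0 : ℝ) ≤ (L : ℝ) - 2 by linarith), hC]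
    _ ≤ Gg * ((L : ℝ) - 1) := mul_le_mul_of_nonneg_right hbound hL1.le

end Summit.AtomisticToContinuum.FouriersLaw.Cruxes.ConductanceLowerBound.ColdBathRelocationWalk

end
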